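import Summits.AtomisticToContinuum.Crystallization.Theorems.FrustratedLawDichotomyStrainedPatchHomSlopeLJAffine2Tab

/-!
# K1-v2 kernel, PER-LABEL TABULATED RECORDS: each label's `27` third-derivative entries and `3` `w_b` components evaluated ONCE (kernel cost ÷ 9 on `W2`)
# (27623 `(H) HomFloor (1/625)`, hcp half; hand-1 g34 FINDING §4)

decomp-a2c hand-1 g34 (crux `AperiodicFrustratedLawGap`, stmt-AtomisticToContinuum-27623).  Kernel-cost device only (values provably equal to `…Affine2Tab`):
`…Affine2Tab` still evaluates `Darr r.L k k' i` afresh inside each of the `351` tensor accumulations (`≈ 1.2·10⁵` evaluations of the `8`-product closed form;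
seat `#eval` 256 s, kernel > 600 s).  Here every label record carries its OWN tables (`LabT`: `D = memo3³ (Darr (recLJ …))`, `W = memo3 (wVec …)`), so the
tensor accumulations are table look-ups and products only: `recsT`, `T0R/W1R/W2R`, `resQR`, `slopeGsLJA2R`, `htGsA2R`, `htGsSumA2R` (the slope inequality ALONE,
so that the certificate side can be certified as TWO kernel facts), `htCertRestA2` (the other conjuncts), ★ `htCertSideA2F_of_parts`.

Kernel definitions + definitional equalities; 0 sorry; standard axioms; no instances / notation / `#eval`.  `--supports stmt-AtomisticToContinuum-27623`.
-/

noncomputable section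

namespace Summit.AtomisticToContinuum.Crystallization.Theorems.FrustratedLawDichotomyStrainedPatchHomEntryLeafHT

open Literature.Analysis.ValidatedNumerics.Numerics
open Literature.Analysis.ValidatedNumerics.IntervalGershgorin (lsum)
open Summit.AtomisticToContinuum.Crystallization.Theorems.FrustratedLawDichotomyStrainedPatchHomCurvKit (accFI)
open Summit.AtomisticToContinuum.Crystallization.Theorems.FrustratedLawDichotomyStrainedPatchHomCurvCentreKit
open Summit.AtomisticToContinuum.Crystallization.Theorems.FrustratedLawDichotomyStrainedPatchHomCurvLJ (recLJ ljLabelOK naiveLJ curvCheckLJM)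
open Summit.AtomisticToContinuum.Crystallization.Theorems.FrustratedLawDichotomyStrainedPatchHomForceJacN (forceJacCheckN)
open Summit.AtomisticToContinuum.Crystallization.Theorems.FrustratedLawDichotomyStrainedPatchHomForceHcp (xiBallOK)
open Summit.AtomisticToContinuum.Crystallization.Theorems.FrustratedLawDichotomyStrainedPatchHomSlopeLJ
open Summit.AtomisticToContinuum.Crystallization.Theorems.FrustratedLawDichotomyStrainedPatchHomSlopeLJAffine
open Summit.AtomisticToContinuum.Crystallization.Theorems.FrustratedLawDichotomyStrainedPatchHomSlopeLJAffine2Kit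

/-- Per-label record with ITS OWN tables: `D k k' i = Darr (recLJ …) k k' i`, `W l = wVec l` (each entry `let`-bound once). -/
structure LabT where
  /-- label record -/
  L : CenLabel
  /-- third-derivative table -/
  D : Fin 3 → Fin 3 → Fin 3 → FI
  /-- `w_b` table -/
  W : Fin 3 → FI

/-- The tabulated record of a label. -/
def labT (c w' : (Fin 3 × Fin 3) ⊕ Fin 3 → ℤ) (b : Fin 3 → ℤ) : LabT :=
  let L := recLJ c w' b
  ⟨L, memo3 fun k => memo3 fun k' => memo3 fun i => Darr L k k' i, memo3 fun l => wVec c b l⟩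

/-- The shared list of tabulated records. -/
def recsT (c w : (Fin 3 × Fin 3) ⊕ Fin 3 → ℤ) (J : Fin 3 → Fin 3 × Fin 3 → ℤ) (Lc : List (Fin 3 → ℤ)) : List LabT := Lc.map (labT c (hullW J w))

/-- `labT` agrees with `labA2` entrywise. [formal bookkeeping] -/
theorem labT_D (c w' : (Fin 3 × Fin 3) ⊕ Fin 3 → ℤ) (b : Fin 3 → ℤ) (k k' i : Fin 3) : (labT c w' b).D k k' i = Darr (recLJ c w' b) k k' i := by
  simp only [labT, memo3_apply]
/-- `labT` agrees with `wVec`. [formal bookkeeping] -/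
theorem labT_W (c w' : (Fin 3 × Fin 3) ⊕ Fin 3 → ℤ) (b : Fin 3 → ℤ) (l : Fin 3) : (labT c w' b).W l = wVec c b l := by
  simp only [labT, memo3_apply]
/-- `labT` record. [formal bookkeeping] -/
theorem labT_L (c w' : (Fin 3 × Fin 3) ⊕ Fin 3 → ℤ) (b : Fin 3 → ℤ) : (labT c w' b).L = recLJ c w' b := rfl

/-- `T0` over tabulated records. -/
def T0R (rs : List LabT) (k k' i : Fin 3) : FI := lsum (rs.map fun r => r.D k k' i)
/-- `W1` over tabulated records. -/
def W1R (rs : List LabT) (l k k' i : Fin 3) : FI := lsum (rs.map fun r => (r.W l).mul (r.D k k' i))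
/-- `W2` over tabulated records. -/
def W2R (rs : List LabT) (l l' k k' i : Fin 3) : FI := lsum (rs.map fun r => (r.W l).mul ((r.W l').mul (r.D k k' i)))
/-- `M`-table of a tabulated record. -/
def MfiR (c : (Fin 3 × Fin 3) ⊕ Fin 3 → ℤ) (J : Fin 3 → Fin 3 × Fin 3 → ℤ) (r : LabT) (k : Fin 3) (a : Fin 3 × Fin 3) : FI :=
  if k = a.1 then (r.W a.2).add (cJ c J k a) else cJ c J k a
/-- `mD` of a tabulated record. -/
def mDbR (c w : (Fin 3 × Fin 3) ⊕ Fin 3 → ℤ) (J : Fin 3 → Fin 3 × Fin 3 → ℤ) (r : LabT) (k : Fin 3) : ℤ :=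
  cdiv (∑ a : Fin 3 × Fin 3, (MfiR c J r k a).absHi * w (Sum.inl a)) SC
/-- `resQ` over tabulated records (the `mD` row of each record `let`-bound once). -/
def resQR (c w : (Fin 3 × Fin 3) ⊕ Fin 3 → ℤ) (J : Fin 3 → Fin 3 × Fin 3 → ℤ) (rs : List LabT) (i : Fin 3) : ℤ :=
  (rs.map fun r =>
    let m := memo3 fun k => mDbR c w J r k
    ∑ k : Fin 3, ∑ k' : Fin 3, cdiv ((m k * ubA J w k' + ubA J w k * m k' + ubA J w k * ubA J w k') * (r.D k k' i).absHi) SC).sum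
/-- ★ The second-order affine slope constant from tabulated records. -/
def slopeGsLJA2R (c w : (Fin 3 × Fin 3) ⊕ Fin 3 → ℤ) (J : Fin 3 → Fin 3 × Fin 3 → ℤ) (Lc Ln : List (Fin 3 → ℤ)) : ℤ :=
  let rs := recsT c w J Lc
  let t0 := memo3 fun k => memo3 fun k' => memo3 fun i => T0R rs k k' i
  let w1 := memo3 fun l => memo3 fun k => memo3 fun k' => memo3 fun i => W1R rs l k k' i
  let w2 := memo3 fun l => memo3 fun l' => memo3 fun k => memo3 fun k' => memo3 fun i => W2R rs l l' k k' i
  let qv := fun i => cdiv (∑ a : Fin 3 × Fin 3, ∑ a' : Fin 3 × Fin 3, cdiv (w (Sum.inl a) * w (Sum.inl a')) SC * (QarrT c J t0 w1 w2 i a a').absHi +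
    resQR c w J rs i) (2 * SC)
  let q0 := qv 0
  let q1 := qv 1
  let q2 := qv 2
  g0LJ c Lc + linLJA c w J Lc + (FI.sqrt ⟨0, cdiv (q0 ^ 2 + q1 ^ 2 + q2 ^ 2) SC⟩).hi + rem3LJ c (hullW J w) Lc + naiSLJ c (hullW J w) Ln

/-- `T0R = T0L`. [formal bookkeeping] -/
theorem T0R_eq (c w : (Fin 3 × Fin 3) ⊕ Fin 3 → ℤ) (J : Fin 3 → Fin 3 × Fin 3 → ℤ) (Lc : List (Fin 3 → ℤ)) (k k' i : Fin 3) :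
    T0R (recsT c w J Lc) k k' i = T0L (recsA2 c w J Lc) k k' i := by
  simp only [T0R, T0L, recsT, recsA2, List.map_map, Function.comp_def, labT_D]; rfl
/-- `W1R = W1L`. [formal bookkeeping] -/
theorem W1R_eq (c w : (Fin 3 × Fin 3) ⊕ Fin 3 → ℤ) (J : Fin 3 → Fin 3 × Fin 3 → ℤ) (Lc : List (Fin 3 → ℤ)) (l k k' i : Fin 3) :
    W1R (recsT c w J Lc) l k k' i = W1L (recsA2 c w J Lc) l k k' i := by
  simp only [W1R, W1L, recsT, recsA2, List.map_map, Function.comp_def, labT_D, labT_W]; rfl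
/-- `W2R = W2L`. [formal bookkeeping] -/
theorem W2R_eq (c w : (Fin 3 × Fin 3) ⊕ Fin 3 → ℤ) (J : Fin 3 → Fin 3 × Fin 3 → ℤ) (Lc : List (Fin 3 → ℤ)) (l l' k k' i : Fin 3) :
    W2R (recsT c w J Lc) l l' k k' i = W2L (recsA2 c w J Lc) l l' k k' i := by
  simp only [W2R, W2L, recsT, recsA2, List.map_map, Function.comp_def, labT_D, labT_W]; rfl
/-- `mDbR = mDbL`. [formal bookkeeping] -/
theorem mDbR_eq (c w : (Fin 3 × Fin 3) ⊕ Fin 3 → ℤ) (J : Fin 3 → Fin 3 × Fin 3 → ℤ) (b : Fin 3 → ℤ) (k : Fin 3) :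
    mDbR c w J (labT c (hullW J w) b) k = mDbL c w J (labA2 c (hullW J w) b) k := by
  simp only [mDbR, mDbL, MfiR, MfiL, labT_W]; rfl
/-- `resQR = resQL`. [formal bookkeeping] -/
theorem resQR_eq (c w : (Fin 3 × Fin 3) ⊕ Fin 3 → ℤ) (J : Fin 3 → Fin 3 × Fin 3 → ℤ) (Lc : List (Fin 3 → ℤ)) (i : Fin 3) :
    resQR c w J (recsT c w J Lc) i = resQL c w J (recsA2 c w J Lc) i := by
  simp only [resQR, resQL, recsT, recsA2, List.map_map, Function.comp_def, memo3_apply, labT_D, mDbR_eq]; rfl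
/-- `slopeGsLJA2R = slopeGsLJA2T`. [formal bookkeeping] -/
theorem slopeGsLJA2R_eq (c w : (Fin 3 × Fin 3) ⊕ Fin 3 → ℤ) (J : Fin 3 → Fin 3 × Fin 3 → ℤ) (Lc Ln : List (Fin 3 → ℤ)) :
    slopeGsLJA2R c w J Lc Ln = slopeGsLJA2T c w J Lc Ln := by
  have ht0 : (memo3 fun k => memo3 fun k' => memo3 fun i => T0R (recsT c w J Lc) k k' i) = tabT0 (recsA2 c w J Lc) := by
    funext k k' i; simp only [memo3_apply, tabT0, T0R_eq]
  have hw1 : (memo3 fun l => memo3 fun k => memo3 fun k' => memo3 fun i => W1R (recsT c w J Lc) l k k' i) = tabW1 (recsA2 c w J Lc) := by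
    funext l k k' i; simp only [memo3_apply, tabW1, W1R_eq]
  have hw2 : (memo3 fun l => memo3 fun l' => memo3 fun k => memo3 fun k' => memo3 fun i => W2R (recsT c w J Lc) l l' k k' i) = tabW2 (recsA2 c w J Lc) := by
    funext l l' k k' i; simp only [memo3_apply, tabW2, W2R_eq]
  simp only [slopeGsLJA2R, slopeGsLJA2T, quadVec2T, ht0, hw1, hw2, resQR_eq]

/-- The chunk slope constant, tabulated records. -/
def htGsA2R (c w : (Fin 3 × Fin 3) ⊕ Fin 3 → ℤ) (J : Fin 3 → Fin 3 × Fin 3 → ℤ) (L : List (Fin 3 → ℤ)) : ℤ :=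
  slopeGsLJA2R c w J (htScA2F c w J L) (htSnA2F c w J L)
/-- `htGsA2R = htGsA2F`. [formal bookkeeping] -/
theorem htGsA2R_eq (c w : (Fin 3 × Fin 3) ⊕ Fin 3 → ℤ) (J : Fin 3 → Fin 3 × Fin 3 → ℤ) (L : List (Fin 3 → ℤ)) : htGsA2R c w J L = htGsA2F c w J L := by
  rw [← htGsA2T_eq]; simp only [htGsA2R, htGsA2T, slopeGsLJA2R_eq]

/-- The slope inequality of the certificate side ALONE (kernel fact 2). -/
def htGsSumA2R (p : HTCert) (J : Fin 3 → Fin 3 × Fin 3 → ℤ) (c w : (Fin 3 × Fin 3) ⊕ Fin 3 → ℤ) : Bool :=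
  decide (htGsA2R c w J (htNearU c w) + htGsNA c w J (htFar1U c w) + htGsNA c w J (htFar2U c w) ≤ p.Gs)
/-- The remaining conjuncts of the certificate side (kernel fact 1). -/
def htCertRestA2 (p : HTCert) (J : Fin 3 → Fin 3 × Fin 3 → ℤ) (c w : (Fin 3 × Fin 3) ⊕ Fin 3 → ℤ) : Bool :=
  xiBallOK c w && jacOK J w && htROKU c w && htCertOKU p c w &&
    curvCheckLJM c w (htCenU c w) (htNaiU c w) p.D p.lam₁ && forceJacCheckN c w (htFar1U c w) p.lam₂ && forceJacCheckN c w (htFar2U c w) p.lam₃ &&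
    (htNaiOKA2F c w J (htNearU c w) && htNaiOKNA c w J (htFar1U c w) && htNaiOKNA c w J (htFar2U c w))
/-- ★ The certificate side from its two kernel facts. [formal bookkeeping] -/
theorem htCertSideA2F_of_parts {p : HTCert} {J : Fin 3 → Fin 3 × Fin 3 → ℤ} {c w : (Fin 3 × Fin 3) ⊕ Fin 3 → ℤ}
    (h1 : htCertRestA2 p J c w = true) (h2 : htGsSumA2R p J c w = true) : htCertSideA2F p J c w = true := by
  have h2' : decide (htGsA2F c w J (htNearU c w) + htGsNA c w J (htFar1U c w) + htGsNA c w J (htFar2U c w) ≤ p.Gs) = true := by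
    rw [← htGsA2R_eq]; exact h2
  unfold htCertSideA2F
  unfold htCertRestA2 at h1
  rw [h1, h2']
  rfl

end Summit.AtomisticToContinuum.Crystallization.Theorems.FrustratedLawDichotomyStrainedPatchHomEntryLeafHT

end
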